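import Literature.AlgebraicGeometry.HodgeTheory.CyclicCoverPencilLocalFibre
import Literature.AlgebraicGeometry.HodgeTheory.CyclicCoverPencilMonodromyMap
import Literature.Geometry.ComplexAnalytic.PhamBrieskornCyclicNodeLocalisationHomotopy
import Literature.Geometry.ComplexAnalytic.PhamBrieskornWeightedRotation
import HarnessLib

/-!
# The local-monodromy datum of the geometric monodromy of a member of the nodal pencil (localisation principle applied)

Family `hodge`, layer `Literature/AlgebraicGeometry/HodgeTheory`; step A4b of the programme discharging
`carlsonToledo1999_nodalMeridianLocalMonodromyBound` (crux K1 of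
`Summits/HodgeConjecture/HodgeConjecture/Theses/CyclicUnitaryPowers.lean`). Fix a member `X_c = pencilFibre p c` (`0 < |c| < δ₀`)
of the pencil `x₃^p = f₁ + c·x₂^p` read in the regular locus, and let `h₁ : S → S` be the time-one geometric monodromy map
(`exists_pencil_monodromyMap`: continuous on `{c ≠ 0}`, `c(h₁ x) = c(x)`, `F` preserved below `T`, the identity where `F ≥ t₂`) together
with its homotopy `H` to the model monodromy `J(2π, ·)` on the Morse ball. Then (`localMonodromy_datum`):

* `h₁` restricts to a continuous self-map `hY` of `X_c`, the identity on `B = {F > t₂}` and preserving `A = {F < T'}`;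
* on `A`, through the local Milnor fibre chart `e : A → F_a` of `CyclicCoverPencilLocalFibre` (injective on `H₂`), `hY` is homotopic
  to Carlson–Toledo's model monodromy `(z₀, z₁, z₂) ↦ (−z₀, −z₁, e^{2πi/p} z₂)` of the Pham–Brieskorn fibre `F_a`, `a = (2, 2, p)` — the
  homotopy is `e ∘ H(s, ·)`, and `e ∘ J(2π, ·) = model ∘ e` because `J(2π, ·)` is the weighted rotation `R_{2π}` in the Morse chart
  (`weightedRotation_two_pi_cyclicNode`);
* hence, by the localisation principle `PhamBrieskorn.exists_localisation_of_homotopyConj_modelMonodromy` (Mayer–Vietoris for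
  `X_c = A ∪ B` + no invariants of the model on `H₂(F_a)`), **every automorphism `T` of `H²(X_c; ℚ)` acting as `hY^*` carries the
  local-monodromy datum**: `∃ V, (T − 1)H² ⊆ V ∧ Σ_{i<p} Tⁱ|_V = 0 ∧ dim V ≤ p − 1`.

Everything is proved; no definitions, no named facts.

## References

* [ArnoldGuseinzadeVarchenko2012] V. I. Arnold, S. M. Gusein-Zade, A. N. Varchenko, Singularities of Differentiable Maps II (2012),
  Part I §1.1, §2.1 (held text p0013, p0025).
* [Milnor1968] J. Milnor, Singular Points of Complex Hypersurfaces, §9 Thm. 9.1, Lemma 9.4.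
* [CarlsonToledo1999] J. A. Carlson, D. Toledo, Duke Math. J. 97 (1999), §6 (kdoublept) (held text p0013–p0014).
-/

noncomputable section

open CategoryTheory AlgebraicGeometry MvPolynomial TopologicalSpace Set Topology Filter Complex
open scoped Manifold ContDiff Real unitInterval
open Literature.AlgebraicGeometry.Motives Literature.AlgebraicGeometry.Motives.UniversalHypersurface
open Literature.AlgebraicGeometry.HodgeTheory.UniversalHypersurface Literature.Geometry.ComplexAnalytic Literature.Geometry.Manifold
open Literature.AlgebraicTopology.SingularHomology

namespace Literature.AlgebraicGeometry.HodgeTheory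

section LocalMonodromy

/-- `negPairFibre` on points. [cite: CarlsonToledo1999, §6 (kdoublept) (held text p0013)] -/
theorem negPairFibre_apply_coe_cyclicNode {p : ℕ} (z : ↥(PhamBrieskorn.fibre (PhamBrieskorn.cyclicNodeExponents p))) :
    ((PhamBrieskorn.negPairFibre (PhamBrieskorn.cyclicNodeExponents p) (i := 0) (j := 1) (by decide) rfl rfl z :
        ↥(PhamBrieskorn.fibre (PhamBrieskorn.cyclicNodeExponents p))) : Fin (1 + 2) → ℂ) =
      fun k => if k = 0 ∨ k = 1 then -(z : Fin (1 + 2) → ℂ) k else (z : Fin (1 + 2) → ℂ) k :=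
  rfl

variable {p : ℕ} (hp : 3 ≤ p)
  (Φ : OpenPartialHomeomorph (ComplexPoints (regularTotal ℂ 2 p)) (({m : DegIndex 2 p // m ≠ regPowIndex 2 p 2} ⊕ Fin (2 + 1)) → ℂ))
  (hΦ : ⇑Φ = regChartFun 2 p 2) (hΦs : Φ.source = regChartDom 2 p 2) (hΦt : Φ.target = regChartFun 2 p 2 '' regChartDom 2 p 2)
  (Θ : OpenPartialHomeomorph (Fin (1 + 2) → ℂ) (Fin (1 + 2) → ℂ)) {r R''' R'' : ℝ}
  (hr : {z : Fin (1 + 2) → ℂ | ∑ i, ‖z i‖ ^ 2 ≤ r ^ 2} ⊆ Θ.target)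
  (hΘ : ContDiffOn ℝ ∞ Θ Θ.source) (hR'' : {z : Fin (1 + 2) → ℂ | ∑ i, ‖z i‖ ^ 2 ≤ R''} ⊆ Θ.target)
  (hΘφ : ∀ x ∈ Θ.source, ∑ i, (Θ x) i ^ PhamBrieskorn.cyclicNodeExponents p i = x 2 ^ p - (x 0 * x 1 + x 0 ^ p + x 1 ^ p))
  {ρW : ℝ}
  (hns : ∀ c : ℂ, c ≠ 0 → ‖c‖ < ρW → SmoothHypersurface.IsNonsingularForm ℂ (formOfCoeffs
    (coeffsOf 2 p (cyclicCoverForm p (X 2 ^ (p - 2) * (X 0 * X 1) + X 0 ^ p + X 1 ^ p)) - Pi.single (regPowIndex 2 p 2) c)))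
  (hR : R''' < R'') {t₂ T' T δ₀ : ℝ} (hTR : T ≤ R''') (hTr : T ≤ r ^ 2) (ht₂T' : t₂ < T') (hT'T : T' < T) (hδρ : δ₀ ≤ ρW)
  -- the time-one monodromy map and its homotopy to the model (outputs of `exists_pencil_monodromyMap`)
  (h₁ : pencilSlice p → pencilSlice p)
  (hh₁c : Continuous fun x : {x : pencilSlice p // pencilCoord p x.1 ≠ 0} => h₁ x.1)
  (hh₁pc : ∀ x, pencilCoord p x.1 ≠ 0 → ‖pencilCoord p x.1‖ < δ₀ → pencilCoord p (h₁ x).1 = pencilCoord p x.1)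
  (hh₁F : ∀ x, pencilCoord p x.1 ≠ 0 → ‖pencilCoord p x.1‖ < δ₀ → satRadius p Θ R''' R'' x.1 < T →
    satRadius p Θ R''' R'' (h₁ x).1 = satRadius p Θ R''' R'' x.1)
  (hh₁id : ∀ x, pencilCoord p x.1 ≠ 0 → ‖pencilCoord p x.1‖ < δ₀ → t₂ ≤ satRadius p Θ R''' R'' x.1 → h₁ x = x)
  (H : ℝ × pencilSlice p → pencilSlice p)
  (hHc : ContinuousOn H (univ ×ˢ {x : pencilSlice p |
    satRadius p Θ R''' R'' x.1 < T ∧ pencilCoord p x.1 ≠ 0 ∧ ‖pencilCoord p x.1‖ < δ₀}))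
  (hH : ∀ s x, pencilCoord p x.1 ≠ 0 → ‖pencilCoord p x.1‖ < δ₀ → satRadius p Θ R''' R'' x.1 < T →
    pencilCoord p (H (s, x)).1 = pencilCoord p x.1 ∧
    satRadius p Θ R''' R'' (H (s, x)).1 = satRadius p Θ R''' R'' x.1 ∧
    (H (0, x)).1 = chartModelIsotopy (PhamBrieskorn.cyclicNodeExponents p) Φ Θ (2 * π) x.1 ∧
    (satRadius p Θ R''' R'' x.1 ≤ T' → H (1, x) = h₁ x))
  {c : ℂ} (hc0 : c ≠ 0) (hcδ : ‖c‖ < δ₀)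
  (lam : Fin (1 + 2) → ℂ) (hlam : ∀ i, lam i ^ PhamBrieskorn.cyclicNodeExponents p i = c) (hlamT : ∑ i, ‖lam i‖ ^ 2 < T')
include hp hΦ hΦs hΦt hr hΘ hR'' hΘφ hns hR hTR hTr ht₂T' hT'T hδρ hh₁c hh₁pc hh₁F hh₁id hHc hH hc0 hcδ hlam hlamT

/-- **The local-monodromy datum for the geometric monodromy of the member `X_c`.** With the data above (`0 < |c| < δ₀ ≤ ρW`,
`λᵢ^{aᵢ} = c`, `Σ|λᵢ|² < T'`, `t₂ < T' < T ≤ min(R''', r²)`): the time-one monodromy `h₁` restricts to a continuous self-map `hY` of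
`X_c = pencilFibre p c`, and every automorphism `T` of `H²(X_c; ℚ)` with `T = hY^*` admits a subspace `V` with `(T − 1)H² ⊆ V`,
`Σ_{i<p} Tⁱ|_V = 0`, `dim V ≤ p − 1`. [cite: CarlsonToledo1999, §6 (kdoublept) (held text p0013–p0014)] [cite: Milnor1968, §9 Thm. 9.1]
[cite: ArnoldGuseinzadeVarchenko2012, Part I §1.1 (held text p0013, p0025)] -/
theorem localMonodromy_datum :
    ∃ hY : C(↥(pencilFibre p c), ↥(pencilFibre p c)),
      (∀ y : ↥(pencilFibre p c), ((hY y : ↥(pencilFibre p c)) : ComplexPoints (regularTotal ℂ 2 p)) = (h₁ ⟨y.1, y.2.1⟩).1) ∧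
      ∀ τ : singularCohomology ℚ ℚ ↥(pencilFibre p c) 2 ≃ₗ[ℚ] singularCohomology ℚ ℚ ↥(pencilFibre p c) 2,
        (∀ x, τ x = (singularCohomology.map ℚ ℚ hY 2).hom x) →
        ∃ V : Submodule ℚ (singularCohomology ℚ ℚ ↥(pencilFibre p c) 2),
          (∀ x, τ x - x ∈ V) ∧ (∀ v ∈ V, (∑ i ∈ Finset.range p, (τ ^ i) v) = 0) ∧ Module.finrank ℚ V ≤ p - 1 := by
  have hp0 : p ≠ 0 := by omega
  have hd : 0 < p := by omega
  have hcρ : ‖c‖ < ρW := lt_of_lt_of_le hcδ hδρ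
  have hT'R : T' ≤ R''' := hT'T.le.trans hTR
  have hT'r : T' ≤ r ^ 2 := hT'T.le.trans hTr
  set a := PhamBrieskorn.cyclicNodeExponents p with ha_def
  -- points of `X_c` as good points of the slice
  have hgoodc : ∀ y : ↥(pencilFibre p c), pencilCoord p y.1 ≠ 0 ∧ ‖pencilCoord p y.1‖ < δ₀ := fun y => by
    rw [y.2.2]; exact ⟨hc0, hcδ⟩
  -- the restriction `hY` of `h₁` to `X_c`
  let toS : ↥(pencilFibre p c) → {x : pencilSlice p // pencilCoord p x.1 ≠ 0} := fun y => ⟨⟨y.1, y.2.1⟩, (hgoodc y).1⟩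
  have htoS : Continuous toS := (continuous_subtype_val.subtype_mk _).subtype_mk _
  have hmemY : ∀ y : ↥(pencilFibre p c), (h₁ ⟨y.1, y.2.1⟩).1 ∈ pencilFibre p c := fun y =>
    ⟨(h₁ ⟨y.1, y.2.1⟩).2, by rw [hh₁pc ⟨y.1, y.2.1⟩ (hgoodc y).1 (hgoodc y).2]; exact y.2.2⟩
  let hY : C(↥(pencilFibre p c), ↥(pencilFibre p c)) :=
    ⟨fun y => ⟨(h₁ ⟨y.1, y.2.1⟩).1, hmemY y⟩, ((continuous_subtype_val.comp (hh₁c.comp htoS))).subtype_mk _⟩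
  have hYval : ∀ y, ((hY y : ↥(pencilFibre p c)) : ComplexPoints (regularTotal ℂ 2 p)) = (h₁ ⟨y.1, y.2.1⟩).1 := fun y => rfl
  refine ⟨hY, hYval, fun τ hτ => ?_⟩
  -- the open cover `A = {F < T'}`, `B = {F > t₂}`
  have hFc : Continuous (satRadius p Θ R''' R'') := continuous_satRadius p Θ R''' R'' hd hΘ hR hR''
  set A : Set ↥(pencilFibre p c) := {Q | satRadius p Θ R''' R'' Q.1 < T'} with hA_def
  set B : Set ↥(pencilFibre p c) := {Q | t₂ < satRadius p Θ R''' R'' Q.1} with hB_def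
  have hAo : IsOpen A := isOpen_lt (hFc.comp continuous_subtype_val) continuous_const
  have hBo : IsOpen B := isOpen_lt continuous_const (hFc.comp continuous_subtype_val)
  have hAB : A ∪ B = univ := eq_univ_of_forall fun y => by
    by_cases hy : satRadius p Θ R''' R'' y.1 < T'
    · exact Or.inl hy
    · exact Or.inr (lt_of_lt_of_le ht₂T' (not_lt.mp hy))
  have hB : ∀ y ∈ B, hY y = y := fun y hy => Subtype.ext (by
    rw [hYval, hh₁id ⟨y.1, y.2.1⟩ (hgoodc y).1 (hgoodc y).2 (le_of_lt hy)])
  have hAF : ∀ y : ↥A, satRadius p Θ R''' R'' (hY y.1).1 < T' := fun y => by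
    rw [hYval, hh₁F ⟨y.1.1, y.1.2.1⟩ (hgoodc y.1).1 (hgoodc y.1).2 (lt_trans y.2 hT'T)]; exact y.2
  let hA : C(↥A, ↥A) := ⟨fun y => ⟨hY y.1, hAF y⟩, (hY.continuous.comp continuous_subtype_val).subtype_mk _⟩
  have hhA : ∀ y : ↥A, ((hA y : ↥A) : ↥(pencilFibre p c)) = hY y := fun y => rfl
  -- the local Milnor fibre chart
  obtain ⟨e, hinj, he⟩ := exists_localFibreChart hp Φ hΦ hΦs hΦt Θ hr hΘφ hns hR hT'R hT'r hc0 hcρ lam hlam hΘ.continuousOn hlamT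
  -- the model monodromy and the primitive root
  have hζ := PhamBrieskorn.isPrimitiveRoot_exp_two_pi_div hp0
  set model : C(↥(PhamBrieskorn.fibre a), ↥(PhamBrieskorn.fibre a)) :=
    ContinuousMap.comp
      (PhamBrieskorn.negPairFibre a (i := 0) (j := 1) (by decide) rfl rfl : C(↥(PhamBrieskorn.fibre a), ↥(PhamBrieskorn.fibre a)))
      (PhamBrieskorn.rotateFibre a (PhamBrieskorn.cyclicNodeExponents_ne_zero p hp0)
        (⟨Complex.exp ((((2 * π) / p : ℝ) : ℂ) * Complex.I), hζ.pow_eq_one⟩ : PhamBrieskorn.Omega (a (Fin.last 2))) :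
          C(↥(PhamBrieskorn.fibre a), ↥(PhamBrieskorn.fibre a))) with hmodel
  -- the homotopy `e ∘ H(s, ·)` on `A`
  have hD : ∀ y : ↥A, satRadius p Θ R''' R'' y.1.1 < T ∧ pencilCoord p y.1.1 ≠ 0 ∧ ‖pencilCoord p y.1.1‖ < δ₀ := fun y =>
    ⟨lt_trans y.2 hT'T, (hgoodc y.1).1, (hgoodc y.1).2⟩
  have hHmem : ∀ (s : ℝ) (y : ↥A), (H (s, ⟨y.1.1, y.1.2.1⟩)).1 ∈ pencilFibre p c ∧
      satRadius p Θ R''' R'' (H (s, ⟨y.1.1, y.1.2.1⟩)).1 < T' := fun s y => by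
    obtain ⟨hpc, hF, -, -⟩ := hH s ⟨y.1.1, y.1.2.1⟩ (hD y).2.1 (hD y).2.2 (hD y).1
    exact ⟨⟨(H (s, ⟨y.1.1, y.1.2.1⟩)).2, by rw [hpc]; exact y.1.2.2⟩, by rw [hF]; exact y.2⟩
  let pt : ℝ × ↥A → ↥A := fun sy => ⟨⟨(H (sy.1, ⟨sy.2.1.1, sy.2.1.2.1⟩)).1, (hHmem sy.1 sy.2).1⟩, (hHmem sy.1 sy.2).2⟩
  have hptc : Continuous pt := by
    refine Continuous.subtype_mk (Continuous.subtype_mk ?_ _) _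
    have hin : Continuous fun sy : ℝ × ↥A => ((sy.1, ⟨sy.2.1.1, sy.2.1.2.1⟩) : ℝ × pencilSlice p) :=
      continuous_fst.prodMk ((continuous_subtype_val.comp (continuous_subtype_val.comp continuous_snd)).subtype_mk _)
    exact continuous_subtype_val.comp (hHc.comp_continuous hin fun sy => ⟨mem_univ _, hD sy.2⟩)
  let G : C(I × ↥A, ↥(PhamBrieskorn.fibre a)) :=
    ⟨fun sy => e (pt (sy.1, sy.2)), e.continuous.comp (hptc.comp ((continuous_subtype_val.comp continuous_fst).prodMk continuous_snd))⟩
  -- `G(0, ·) = model ∘ e`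
  have hG0 : ∀ y : ↥A, G (0, y) = model (e y) := by
    intro y
    obtain ⟨-, -, hH0, -⟩ := hH 0 ⟨y.1.1, y.1.2.1⟩ (hD y).2.1 (hD y).2.2 (hD y).1
    obtain ⟨hx, hyΘ, hyr, -, -⟩ := monodromyMap_good hp Φ hΦ hΦs hΦt Θ hr hΘφ hns hR hTR hTr y.1.2.1 (hD y).1 (hD y).2.1
      (lt_of_lt_of_le (hD y).2.2 hδρ)
    have haff := affine_chartModelIsotopy hp Φ hΦ hΦs hΦt Θ hr hΘφ hns hx y.1.2.1 hyΘ hyr (hD y).2.1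
      (lt_of_lt_of_le (hD y).2.2 hδρ) (2 * π)
    obtain ⟨-, happ, -⟩ := PhamBrieskorn.modelIsotopy_mem a Θ hr hyr (2 * π)
    apply Subtype.ext
    change (e (pt ((0 : I), y)) : Fin (1 + 2) → ℂ) = (model (e y) : Fin (1 + 2) → ℂ)
    rw [he, hmodel, ContinuousMap.comp_apply]
    change (fun i => Θ (fun j => regChartFun 2 p 2 (H ((0 : ℝ), ⟨y.1.1, y.1.2.1⟩)).1 (Sum.inr j)) i / lam i) = _
    rw [hH0, haff, happ, PhamBrieskorn.weightedRotation_two_pi_cyclicNode]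
    rw [show ((PhamBrieskorn.negPairFibre a (i := 0) (j := 1) (by decide) rfl rfl :
        C(↥(PhamBrieskorn.fibre a), ↥(PhamBrieskorn.fibre a)))
        ((PhamBrieskorn.rotateFibre a (PhamBrieskorn.cyclicNodeExponents_ne_zero p hp0)
          (⟨Complex.exp ((((2 * π) / p : ℝ) : ℂ) * Complex.I), hζ.pow_eq_one⟩ : PhamBrieskorn.Omega (a (Fin.last 2))) :
            C(↥(PhamBrieskorn.fibre a), ↥(PhamBrieskorn.fibre a))) (e y)) : Fin (1 + 2) → ℂ) =
        fun k => if k = 0 ∨ k = 1 then -(PhamBrieskorn.rotateFun (Complex.exp ((((2 * π) / p : ℝ) : ℂ) * Complex.I)) (e y : Fin (1 + 2) → ℂ)) k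
          else (PhamBrieskorn.rotateFun (Complex.exp ((((2 * π) / p : ℝ) : ℂ) * Complex.I)) (e y : Fin (1 + 2) → ℂ)) k from rfl]
    rw [he y]
    funext k
    fin_cases k <;> simp [PhamBrieskorn.rotateFun, Fin.snoc, neg_div, mul_div_assoc]
  -- `G(1, ·) = e ∘ hA`
  have hG1 : ∀ y : ↥A, G (1, y) = e (hA y) := by
    intro y
    obtain ⟨-, -, -, hH1⟩ := hH 1 ⟨y.1.1, y.1.2.1⟩ (hD y).2.1 (hD y).2.2 (hD y).1
    change e (pt ((1 : ℝ), y)) = e (hA y)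
    congr 1
    apply Subtype.ext; apply Subtype.ext
    change (H ((1 : ℝ), ⟨y.1.1, y.1.2.1⟩)).1 = (h₁ ⟨y.1.1, y.1.2.1⟩).1
    rw [hH1 (le_of_lt y.2)]
  have hconj : (e.comp hA).Homotopic (model.comp e) :=
    ⟨{ toContinuousMap := G
       map_zero_left := fun y => by rw [ContinuousMap.comp_apply]; exact hG0 y
       map_one_left := fun y => by rw [ContinuousMap.comp_apply]; exact hG1 y : ContinuousMap.Homotopy (model.comp e) (e.comp hA) }.symm⟩
  rw [hmodel] at hconj
  exact PhamBrieskorn.exists_localisation_of_homotopyConj_modelMonodromy p (by omega) hζ hAo hBo hAB hY hB hA hhA e hinj hconj τ hτ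

end LocalMonodromy

end Literature.AlgebraicGeometry.HodgeTheory

end
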